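import Mathlib
import HarnessLib
import Summits.Ventures.LatticeQCDFlow.Exactness.OpenBoundaryWilsonAction

/-!
# Open temporal boundary: ALL dead links together are independent Haar spectators under the engine's open-boundary Gibbs law

HONEST FRAMING: exact (Metropolis-corrected) sampling algorithms for lattice gauge theory;
figures of merit are autocorrelation/cost numbers at stated couplings and volumes; no
continuum-physics claim.

Venture `LatticeQCDFlow` (cell pub-lqcd), topic `Exactness`, FANOUT row 21 (`su3-base`, arm `OBC-HMC`: open boundary
conditions in time realised by the engine on the periodic lattice through plaquette weights).  NEW WORK of the cell over
row 21's `OpenBoundaryWilsonAction.lean` (`obcWeight`, `obcAction`, the one-link statement `obcGibbs_inter_deadLink_eq`: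
for ONE dead link `e`, `P(A ∩ {U_e ∈ B}) = P(A)·Haar(B)` for every event `A` not reading `e`).  Nothing is cited as a
fact; no number; no definition is introduced.

* `update_mem_linkEvent_iff` — an event `{U | U_{e'} ∈ B}` does not read a different link `e`;
* **`obcGibbs_inter_deadLinks_eq`** — compact second-countable `G`, continuous `ρ`, any real `β`, time direction `τ`:
  for every FINITE SET `D` of dead links (`e.2 = τ`, `e.1 τ = −1`), every family of measurable `B_e ⊆ G` and every
  measurable event `A` that reads no link of `D`,
  `P(A ∩ {U | ∀ e ∈ D, U_e ∈ B_e}) = P(A) · ∏_{e ∈ D} Haar(B_e)` under `Z⁻¹e^{−βS_OBC}·Haar^{⊗ edges}` — the dead links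
  are JOINTLY independent of the live field and i.i.d. Haar: the periodic bookkeeping with zero wrap weights is the open
  lattice times a product of Haar spectators (induction on `D` over the one-link statement);
* `obcGibbs_deadLinks_eq` — the case `A = univ`: `P(∀ e ∈ D, U_e ∈ B_e) = ∏_{e ∈ D} Haar(B_e)`.

NOT CLAIMED: a product-measure (push-forward) formulation; `c_G ≠ 1`; anything about observables of the live links
beyond "their law does not see the dead ones"; floating point.
-/

noncomputable section

namespace Summit.Ventures.LatticeQCDFlow.Exactness

open MeasureTheory Set Function
open Literature.MathematicalPhysics.QuantumFieldTheory
open scoped ENNReal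

variable {d L N : ℕ} [NeZero L] {G : Type*} [Group G] [TopologicalSpace G] [IsTopologicalGroup G] [CompactSpace G]
  [MeasurableSpace G] [BorelSpace G] [SecondCountableTopology G] (ρ : G →* Matrix (Fin N) (Fin N) ℂ)

omit [NeZero L] [Group G] [TopologicalSpace G] [IsTopologicalGroup G] [CompactSpace G] [MeasurableSpace G] [BorelSpace G]
  [SecondCountableTopology G] in
/-- An event reading only the link `e'` does not read a different link `e`. -/
theorem update_mem_linkEvent_iff {e e' : Edge d L} (hne : e' ≠ e) (B : Set G) (U : GaugeConfig d L G) (h : G) :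
    Function.update U e h ∈ {V : GaugeConfig d L G | V e' ∈ B} ↔ U ∈ {V : GaugeConfig d L G | V e' ∈ B} := by
  simp only [Set.mem_setOf_eq, Function.update_of_ne hne]

/-- **ALL DEAD LINKS ARE JOINTLY INDEPENDENT HAAR SPECTATORS** under the open-boundary Gibbs law: for a finite set
`D` of dead links, measurable `B_e ⊆ G` and a measurable event `A` reading no link of `D`,
`P(A ∩ {∀ e ∈ D, U_e ∈ B_e}) = P(A) · ∏_{e ∈ D} Haar(B_e)`. -/
theorem obcGibbs_inter_deadLinks_eq (hρ : Continuous ρ) (τ : Fin d) (β : ℝ) (D : Finset (Edge d L))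
    (hD : ∀ e ∈ D, e.2 = τ ∧ e.1 τ = -1) {B : Edge d L → Set G} (hB : ∀ e ∈ D, MeasurableSet (B e))
    {A : Set (GaugeConfig d L G)} (hA : MeasurableSet A)
    (hAD : ∀ e ∈ D, ∀ (U : GaugeConfig d L G) (h : G), Function.update U e h ∈ A ↔ U ∈ A) :
    gibbsProbability (Measure.pi fun _ : Edge d L => haarProbability G) (fun U => Real.exp (-(β * obcAction ρ τ U)))
        (A ∩ {U | ∀ e ∈ D, U e ∈ B e})
      = gibbsProbability (Measure.pi fun _ : Edge d L => haarProbability G) (fun U => Real.exp (-(β * obcAction ρ τ U))) A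
          * ∏ e ∈ D, haarProbability G (B e) := by
  classical
  induction D using Finset.induction_on generalizing A with
  | empty =>
    simp only [Finset.notMem_empty, IsEmpty.forall_iff, implies_true, Set.setOf_true, Set.inter_univ,
      Finset.prod_empty, mul_one]
  | @insert e₀ D he₀ ih =>
    have hD' : ∀ e ∈ D, e.2 = τ ∧ e.1 τ = -1 := fun e he => hD e (Finset.mem_insert_of_mem he)
    have hB' : ∀ e ∈ D, MeasurableSet (B e) := fun e he => hB e (Finset.mem_insert_of_mem he)
    have hE₀ : MeasurableSet {U : GaugeConfig d L G | U e₀ ∈ B e₀} :=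
      measurable_pi_apply e₀ (hB e₀ (Finset.mem_insert_self e₀ D))
    -- split the event at `e₀`
    have hsplit : A ∩ {U : GaugeConfig d L G | ∀ e ∈ insert e₀ D, U e ∈ B e}
        = (A ∩ {U : GaugeConfig d L G | U e₀ ∈ B e₀}) ∩ {U : GaugeConfig d L G | ∀ e ∈ D, U e ∈ B e} := by
      ext U
      simp only [Set.mem_inter_iff, Set.mem_setOf_eq, Finset.forall_mem_insert, and_assoc]
    -- the enlarged event `A ∩ {U_{e₀} ∈ B_{e₀}}` reads no link of `D` (`e₀ ∉ D`)
    have hAD' : ∀ e ∈ D, ∀ (U : GaugeConfig d L G) (h : G),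
        Function.update U e h ∈ A ∩ {U : GaugeConfig d L G | U e₀ ∈ B e₀}
          ↔ U ∈ A ∩ {U : GaugeConfig d L G | U e₀ ∈ B e₀} := by
      intro e he U h
      have hne : e₀ ≠ e := fun h' => he₀ (h' ▸ he)
      rw [Set.mem_inter_iff, Set.mem_inter_iff, hAD e (Finset.mem_insert_of_mem he) U h,
        update_mem_linkEvent_iff hne (B e₀) U h]
    rw [hsplit, ih hD' hB' (hA.inter hE₀) hAD', Finset.prod_insert he₀,
      obcGibbs_inter_deadLink_eq ρ hρ τ β (hD e₀ (Finset.mem_insert_self e₀ D)).1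
        (hD e₀ (Finset.mem_insert_self e₀ D)).2 hA (hAD e₀ (Finset.mem_insert_self e₀ D))
        (hB e₀ (Finset.mem_insert_self e₀ D))]
    ring

/-- **The dead links are i.i.d. Haar**: `P(∀ e ∈ D, U_e ∈ B_e) = ∏_{e ∈ D} Haar(B_e)` (the case `A = univ`; `P` is a
probability law because `β S_OBC` is bounded on the compact configuration space). -/
theorem obcGibbs_deadLinks_eq (hρ : Continuous ρ) (τ : Fin d) (β : ℝ) (D : Finset (Edge d L))
    (hD : ∀ e ∈ D, e.2 = τ ∧ e.1 τ = -1) {B : Edge d L → Set G} (hB : ∀ e ∈ D, MeasurableSet (B e)) :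
    gibbsProbability (Measure.pi fun _ : Edge d L => haarProbability G) (fun U => Real.exp (-(β * obcAction ρ τ U)))
        {U | ∀ e ∈ D, U e ∈ B e}
      = ∏ e ∈ D, haarProbability G (B e) := by
  obtain ⟨s, hs⟩ := exists_bound_smul_obcAction (d := d) (L := L) ρ hρ τ β
  have hlo : ∀ U : GaugeConfig d L G, Real.exp (-s) ≤ Real.exp (-(β * obcAction ρ τ U)) := fun U =>
    Real.exp_le_exp.2 (by linarith [(abs_le.1 (hs U)).2])
  have hhi : ∀ U : GaugeConfig d L G, Real.exp (-(β * obcAction ρ τ U)) ≤ Real.exp s := fun U =>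
    Real.exp_le_exp.2 (by linarith [(abs_le.1 (hs U)).1])
  haveI := isProbabilityMeasure_gibbsProbability
    (μ := Measure.pi fun _ : Edge d L => haarProbability G) (Real.exp_pos (-s)) hlo hhi
  have h := obcGibbs_inter_deadLinks_eq ρ hρ τ β D hD hB MeasurableSet.univ (fun _ _ _ _ => by simp)
  rwa [Set.univ_inter, measure_univ, one_mul] at h

end Summit.Ventures.LatticeQCDFlow.Exactness
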